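import Literature.MathematicalPhysics.StatisticalMechanics.NJLMassAnalyticity
import HarnessLib

/-!
# Locality of the hopping expansion of the NJL system (Salmhofer–Seiler, CMP 139 (1991), §3:
# the large-mass input of Thm. 3.8 / Remark 3.10)

A further file of the Salmhofer–Seiler series (`ComplexSpinInfraredBound`, …, `MonomerDimerZeros`,
`NJLMassAnalyticity`, `MonomerDimerRepresentation`).  The tree has Theorem 3.8 (existence of the
thermodynamic limit of the NJL correlation functions and its analyticity in the mass on
`𝒲 ⊆ ℂ ∖ i[-√(2ν), √(2ν)]`) MODULO one input: the convergence of the finite-volume correlations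
`⟨σ^d⟩_Λ(m)` as `Λ ↗` at LARGE `|m|` (`NJLMassAnalyticity`:
`exists_tendstoLocallyUniformlyOn_njlCorrelation_of_tendsto_real` is Vitali's theorem fed by
zero-freeness (Thm. 3.6) and the volume-independent bounds of the Erratum).  The printed proof of
that input is "contained in [20]" (Gruber–Kunz: the Mayer expansion of the dilute dimer gas).  This
file supplies it by a shorter road which uses only what the tree already has — the Heilmann–Lieb /
Schwinger–Dyson recursion `MonomerDimer.rec` ((3.45)–(3.46); [HeilmannLieb1972] (4.11)) and the
Heilmann–Lieb ratio bounds (Lemma 4.4) — namely the **locality of the hopping expansion**: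

* `njlCapZ_rec`: on the torus the recursion reads
  `c_z Z_Λ(c) = 2Nm Z_Λ(c-δ_z) + N ∑_μ (Z_Λ(c-δ_z-δ_{z+e_μ}) + Z_Λ(c-δ_z-δ_{z-e_μ}))` (terms without
  capacity omitted), i.e. for the one-step ratios `ρ_Λ(z,c) = Z_Λ(c-δ_z)/Z_Λ(c)`:
  `c_z/ρ_Λ(z,c) = 2Nm + N ∑_{y ∼ z} ρ_Λ(y, c-δ_z)` (`njlCapRatio_rec`), a continued fraction in `1/m`.
* `njlCapRatio_locality` (induction on `n` along that continued fraction): if the capacities of two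
  tori `Λ₁`, `Λ₂` agree on boxes of radius `R` around `z₁`, `z₂` (`CapAgree`), `n ≤ 2R+1` and both
  tori are wider than `2R`, then `ρ_{Λ₁}(z₁,c₁)(m) - ρ_{Λ₂}(z₂,c₂)(m) = O(|m|^{-n})` as `|m| → ∞`.
* `njlCapZ_div_locality` (telescoping): the same for the ratios `Z_Λ(c-l)/Z_Λ(c)`, `l` a multi-index
  supported in the box, and `njlCorrelation_sub_isBigO`: for a multi-index `d` on `ℤ^ν` and all
  tori `Λ₁, Λ₂` of side `> 2(R_d + n)`,
  `⟨σ^d⟩_{Λ₁}(m) - ⟨σ^d⟩_{Λ₂}(m) = O(|m|^{-n})` (`|m| → ∞`):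
  **the hopping-parameter expansions (Remark 3.10) of two large tori agree to every prescribed
  order** — the linked-cluster property which, in [20], comes out of the Mayer expansion.

The companion file `NJLThermodynamicLimit` turns this, with the uniform majorant on the hopping disc
(`norm_njlHopping_le`) and a Schwarz lemma of order `n`, into the Cauchy property of
`L ↦ ⟨σ^d⟩_{Λ_L}(m)` at large real `m`, and hence into Theorem 3.8 (1)–(2) and Corollary 3.9 for
the full sequence of tori, unconditionally.

Faithfulness / scope.  Everything here is about the `β = 0` NJL complex spin system of Def. 3.3(1)
(site weight `e^{2Nmσ}`, bond weight `e^{Nσσ'}`, capacities `≤ N`) on the discrete tori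
`(ℤ/Lℤ)^ν`, in the tree's normalisation of `MonomerDimerZeros`; the volumes of the printed
Thm. 3.8 are van Hove sequences of subsets of `ℤ^ν`, the tree's are the tori used throughout this
series (reflection positivity) — the locality argument is insensitive to the difference but only
the torus version is typed.  Nothing about `β > 0`, the continuum, a mass gap or the `QCD` conjunct.

## References

* M. Salmhofer, E. Seiler, *Proof of chiral symmetry breaking in strongly coupled lattice gauge
  theory*, Commun. Math. Phys. 139 (1991) 395–432: Remark 3.2 p. 402, Def. 3.3 p. 403, (3.45)–(3.46)
  p. 410, Thm. 3.8 and Remark 3.10 p. 407. [SalmhoferSeiler1991]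
* O. J. Heilmann, E. H. Lieb, *Theory of monomer-dimer systems*, Commun. Math. Phys. 25 (1972)
  190–232: (4.11), Lemma 4.4, (4.20). [HeilmannLieb1972]
* C. Gruber, H. Kunz, *General properties of polymer systems*, Commun. Math. Phys. 22 (1971)
  133–161 (SS91's [20]). [GruberKunz1971]
-/

noncomputable section

open MvPolynomial Finset Filter Asymptotics Bornology Topology

namespace Literature.MathematicalPhysics.StatisticalMechanics

namespace ComplexSpin

open MonomerDimer

open Literature.Probability.LatticeModels (TorusSite Site)
open Literature.Probability.LatticeModels

variable {ν L : ℕ}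

/-! ### Capacity partition functions of the NJL system on the torus, as functions of the mass -/

section CapZ

variable [NeZero L]

/-- `Z_Λ(c)(m)`: the capacity partition function `[∏_x σ_x^{c_x}] ∏_x e^{2Nmσ_x} ∏_⟨xy⟩ e^{Nσ_xσ_y}`
of the NJL system on the torus `Λ = (ℤ/Lℤ)^ν` at complex mass `m` (`MonomerDimer.Z` with the NJL
data of `MonomerDimerZeros`); `[σ^l]_Λ(m) = Z_Λ(N-l)(m)` (Remark 3.2). [cite: SalmhoferSeiler1991, (3.1) and Remark 3.2] -/
def njlCapZ (N : ℕ) (c : TorusSite ν L →₀ ℕ) (m : ℂ) : ℂ :=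
  MonomerDimer.Z N linkSrc linkTgt (njlSiteData N m) (njlBondData (ν := ν) (L := L) N) c

/-- The one-step ratio `ρ_Λ(z,c)(m) = Z_Λ(c - δ_z)(m) / Z_Λ(c)(m)` ("`Z_{G-i}/Z_G`" of Heilmann–Lieb,
(4.20)); for `c = (N,…,N)` it is the one-point function `⟨σ_z⟩_Λ(m)`. [cite: HeilmannLieb1972, (4.20)][cite: SalmhoferSeiler1991, (3.46)] -/
def njlCapRatio (N : ℕ) (z : TorusSite ν L) (c : TorusSite ν L →₀ ℕ) (m : ℂ) : ℂ :=
  njlCapZ N (c - Finsupp.single z 1) m / njlCapZ N c m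

/-- `‖2Nm‖ = 2N‖m‖`. [folklore] -/
private theorem norm_two_mul_natCast_mul' (N : ℕ) (m : ℂ) : ‖(2 : ℂ) * N * m‖ = 2 * N * ‖m‖ := by
  simp

/-- **The recursion on the torus** (Heilmann–Lieb (4.11) pushed down to capacities = the
Schwinger–Dyson equation (3.46) of the NJL system): for `z` with capacity,
`c_z Z_Λ(c) = 2Nm Z_Λ(c-δ_z) + N ∑_μ (Z_Λ(c-δ_z-δ_{z+e_μ}) + Z_Λ(c-δ_z-δ_{z-e_μ}))`, where a term
is `0` if `c - δ_z` has no capacity left at `z ± e_μ`. [cite: SalmhoferSeiler1991, (3.45)–(3.46)][cite: HeilmannLieb1972, (4.11)] -/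
theorem njlCapZ_rec (N : ℕ) {c : TorusSite ν L →₀ ℕ} (hc : ∀ x, c x ≤ N) {z : TorusSite ν L}
    (hz : z ∈ c.support) (m : ℂ) :
    (c z : ℂ) * njlCapZ N c m =
      2 * N * m * njlCapZ N (c - Finsupp.single z 1) m +
        N * ∑ μ : Fin ν,
          ((if z + Pi.single μ 1 ∈ (c - Finsupp.single z 1).support then
              njlCapZ N (c - Finsupp.single z 1 - Finsupp.single (z + Pi.single μ 1) 1) m else 0) +
            (if z - Pi.single μ 1 ∈ (c - Finsupp.single z 1).support then
              njlCapZ N (c - Finsupp.single z 1 - Finsupp.single (z - Pi.single μ 1) 1) m else 0)) := by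
  classical
  have h := MonomerDimer.rec (D := N) (s := linkSrc) (t := linkTgt) (w := fun _ => ((N : ℝ) : ℂ))
    (fun x => isExpData_njlSiteData (ν := ν) (L := L) N m x) (fun b => isExpData_njlBondData N b) hc hz
  unfold njlCapZ
  rw [h, Complex.ofReal_natCast, ← Finset.mul_sum]
  congr 1
  congr 1
  rw [Fintype.sum_prod_type, Finset.sum_comm]
  refine Finset.sum_congr rfl fun μ _ => ?_
  simp only [linkSrc, linkTgt, MonomerDimer.Zdrop]
  rw [Finset.sum_add_distrib]
  congr 1
  · rw [Finset.sum_ite_eq' Finset.univ z]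
    simp
  · simp_rw [← eq_sub_iff_add_eq (b := z)]
    rw [Finset.sum_ite_eq' Finset.univ (z - Pi.single μ 1)]
    simp

/-- **Heilmann–Lieb for the NJL system with arbitrary capacities `c ≤ N`**: for `‖m‖ ≥ √(2ν)`,
`m ≠ 0`, `N ≥ 1`, `Z_Λ(c)(m) ≠ 0` and every one-step ratio satisfies `‖ρ_Λ(z,c)(m)‖ ≤ c_z/(N‖m‖)`
(Lemma 4.4 with `R = 2N‖m‖`, `W ≤ 2νN²`). [cite: HeilmannLieb1972, Thm. 4.3 and Lemma 4.4][cite: SalmhoferSeiler1991, (3.28)] -/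
theorem njlCapZ_ne_zero_and_norm_njlCapRatio_le {N : ℕ} (hN : 1 ≤ N) {c : TorusSite ν L →₀ ℕ}
    (hc : ∀ x, c x ≤ N) {m : ℂ} (hm0 : m ≠ 0) (hm : Real.sqrt (2 * ν) ≤ ‖m‖) :
    njlCapZ N c m ≠ 0 ∧
      ∀ z ∈ c.support, ‖njlCapRatio N z c m‖ ≤ c z / (N * ‖m‖) := by
  have hN' : (0 : ℝ) < N := by exact_mod_cast hN
  have hm' : 0 < ‖m‖ := norm_pos_iff.2 hm0
  have hsq : 2 * (ν : ℝ) ≤ ‖m‖ ^ 2 := by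
    calc 2 * (ν : ℝ) = Real.sqrt (2 * ν) ^ 2 := (Real.sq_sqrt (by positivity)).symm
      _ ≤ ‖m‖ ^ 2 := pow_le_pow_left₀ (Real.sqrt_nonneg _) hm 2
  have hW : ∀ x, 4 * weightedDegree linkSrc linkTgt (fun _ => (N : ℝ)) c x ≤ (2 * N * ‖m‖) ^ 2 :=
    fun x =>
    calc 4 * weightedDegree linkSrc linkTgt (fun _ => (N : ℝ)) c x
        ≤ 4 * (2 * ν * (N : ℝ) ^ 2) :=
          mul_le_mul_of_nonneg_left (njl_weightedDegree_le N hc x) (by norm_num)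
      _ ≤ (2 * N * ‖m‖) ^ 2 := by nlinarith
  obtain ⟨hZ, hr⟩ := heilmannLieb_rootBound (s := linkSrc) (t := linkTgt) (w := fun _ => (N : ℝ))
    (fun x => isExpData_njlSiteData (ν := ν) (L := L) N m x) (fun b => isExpData_njlBondData N b)
    (fun _ => Nat.cast_nonneg N) (R := 2 * N * ‖m‖) (by positivity)
    (fun x => (norm_two_mul_natCast_mul' N m).symm.le) c hc hW
  refine ⟨hZ, fun z hz => (hr z hz).trans_eq ?_⟩
  rw [mul_assoc, mul_div_mul_left _ _ (two_ne_zero' ℝ)]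

/-- `Z_Λ(c)(m) ≠ 0` for `‖m‖ ≥ √(2ν)`, `m ≠ 0` (capacities `≤ N`, `N ≥ 1`). [cite: SalmhoferSeiler1991, Thm. 3.6 and (3.28)] -/
theorem njlCapZ_ne_zero {N : ℕ} (hN : 1 ≤ N) {c : TorusSite ν L →₀ ℕ} (hc : ∀ x, c x ≤ N)
    {m : ℂ} (hm0 : m ≠ 0) (hm : Real.sqrt (2 * ν) ≤ ‖m‖) : njlCapZ N c m ≠ 0 :=
  (njlCapZ_ne_zero_and_norm_njlCapRatio_le hN hc hm0 hm).1

/-- The one-step ratios are `O(1/m)`: `‖ρ_Λ(z,c)(m)‖ ≤ 1/‖m‖` for `‖m‖ ≥ √(2ν)`, `m ≠ 0`, `z` with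
capacity. [cite: HeilmannLieb1972, Lemma 4.4] -/
theorem norm_njlCapRatio_le_inv {N : ℕ} (hN : 1 ≤ N) {c : TorusSite ν L →₀ ℕ} (hc : ∀ x, c x ≤ N)
    {m : ℂ} (hm0 : m ≠ 0) (hm : Real.sqrt (2 * ν) ≤ ‖m‖) {z : TorusSite ν L} (hz : z ∈ c.support) :
    ‖njlCapRatio N z c m‖ ≤ ‖m‖⁻¹ := by
  have hN' : (0 : ℝ) < N := by exact_mod_cast hN
  have hm' : 0 < ‖m‖ := norm_pos_iff.2 hm0
  refine ((njlCapZ_ne_zero_and_norm_njlCapRatio_le hN hc hm0 hm).2 z hz).trans ?_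
  rw [div_le_iff₀ (by positivity)]
  calc (c z : ℝ) ≤ N := by exact_mod_cast hc z
    _ = ‖m‖⁻¹ * (N * ‖m‖) := by field_simp

/-- The ratio is nonzero in the zero-free region. [cite: SalmhoferSeiler1991, Thm. 3.6 and (3.28)] -/
theorem njlCapRatio_ne_zero {N : ℕ} (hN : 1 ≤ N) {c : TorusSite ν L →₀ ℕ} (hc : ∀ x, c x ≤ N)
    {m : ℂ} (hm0 : m ≠ 0) (hm : Real.sqrt (2 * ν) ≤ ‖m‖) (z : TorusSite ν L) :
    njlCapRatio N z c m ≠ 0 := by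
  unfold njlCapRatio
  refine div_ne_zero (njlCapZ_ne_zero hN (fun x => ?_) hm0 hm) (njlCapZ_ne_zero hN hc hm0 hm)
  rw [Finsupp.tsub_apply]
  exact (Nat.sub_le _ _).trans (hc x)

/-- **Multi-step ratio bound**: `‖Z_Λ(d)(m)/Z_Λ(c)(m)‖ ≤ ‖m‖^{-(|c|-|d|)}` for `d ≤ c ≤ N`,
`‖m‖ ≥ √(2ν)`, `m ≠ 0` — the volume-independent bound `|⟨σ^l⟩_Λ(m)| ≤ |m|^{-|l|}` of the Erratum.
[cite: HeilmannLieb1972, Lemma 4.4][cite: SalmhoferSeiler1992Erratum, (5)] -/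
theorem norm_njlCapZ_div_le {N : ℕ} (hN : 1 ≤ N) {c d : TorusSite ν L →₀ ℕ} (hdc : d ≤ c)
    (hc : ∀ x, c x ≤ N) {m : ℂ} (hm0 : m ≠ 0) (hm : Real.sqrt (2 * ν) ≤ ‖m‖) :
    ‖njlCapZ N d m / njlCapZ N c m‖ ≤ ‖m‖⁻¹ ^ (c.degree - d.degree) := by
  have hN' : (0 : ℝ) < N := by exact_mod_cast hN
  have hm' : 0 < ‖m‖ := norm_pos_iff.2 hm0
  have hsq : 2 * (ν : ℝ) ≤ ‖m‖ ^ 2 := by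
    calc 2 * (ν : ℝ) = Real.sqrt (2 * ν) ^ 2 := (Real.sq_sqrt (by positivity)).symm
      _ ≤ ‖m‖ ^ 2 := pow_le_pow_left₀ (Real.sqrt_nonneg _) hm 2
  have hW : ∀ x, 4 * weightedDegree linkSrc linkTgt (fun _ => (N : ℝ)) c x ≤ (2 * N * ‖m‖) ^ 2 :=
    fun x =>
    calc 4 * weightedDegree linkSrc linkTgt (fun _ => (N : ℝ)) c x
        ≤ 4 * (2 * ν * (N : ℝ) ^ 2) :=
          mul_le_mul_of_nonneg_left (njl_weightedDegree_le N hc x) (by norm_num)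
      _ ≤ (2 * N * ‖m‖) ^ 2 := by nlinarith
  have h := norm_Z_div_Z_le_of_norm (s := linkSrc) (t := linkTgt) (w := fun _ => (N : ℝ))
    (fun x => isExpData_njlSiteData (ν := ν) (L := L) N m x) (fun b => isExpData_njlBondData N b)
    (fun _ => Nat.cast_nonneg N) (R := 2 * N * ‖m‖) (by positivity)
    (fun x => (norm_two_mul_natCast_mul' N m).symm.le) hdc hc hW
  refine h.trans_eq ?_
  rw [div_mul_cancel_left₀ (by positivity) ‖m‖]

/-- **The recursion for the ratios** (Heilmann–Lieb (4.20)): in the zero-free region,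
`c_z / ρ_Λ(z,c) = 2Nm + N ∑_μ (ρ_Λ(z+e_μ, c-δ_z) + ρ_Λ(z-e_μ, c-δ_z))`, a term being `0` when
`c - δ_z` has no capacity at `z ± e_μ`. [cite: HeilmannLieb1972, (4.20)][cite: SalmhoferSeiler1991, (3.46)] -/
theorem njlCapRatio_rec {N : ℕ} (hN : 1 ≤ N) {c : TorusSite ν L →₀ ℕ} (hc : ∀ x, c x ≤ N)
    {z : TorusSite ν L} (hz : z ∈ c.support) {m : ℂ} (hm0 : m ≠ 0) (hm : Real.sqrt (2 * ν) ≤ ‖m‖) :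
    (c z : ℂ) / njlCapRatio N z c m =
      2 * N * m +
        N * ∑ μ : Fin ν,
          ((if z + Pi.single μ 1 ∈ (c - Finsupp.single z 1).support then
              njlCapRatio N (z + Pi.single μ 1) (c - Finsupp.single z 1) m else 0) +
            (if z - Pi.single μ 1 ∈ (c - Finsupp.single z 1).support then
              njlCapRatio N (z - Pi.single μ 1) (c - Finsupp.single z 1) m else 0)) := by
  classical
  set c' := c - Finsupp.single z 1 with hc'
  have hc'le : ∀ x, c' x ≤ N := fun x => by
    rw [hc', Finsupp.tsub_apply]; exact (Nat.sub_le _ _).trans (hc x)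
  have hZ' : njlCapZ N c' m ≠ 0 := njlCapZ_ne_zero hN hc'le hm0 hm
  have hZ : njlCapZ N c m ≠ 0 := njlCapZ_ne_zero hN hc hm0 hm
  have hrec := njlCapZ_rec N hc hz m
  rw [← hc'] at hrec
  unfold njlCapRatio
  rw [← hc', div_div_eq_mul_div, div_eq_iff hZ', hrec, add_mul, mul_assoc (N : ℂ), Finset.sum_mul]
  congr 2
  refine Finset.sum_congr rfl fun μ _ => ?_
  rw [add_mul]
  congr 1 <;> split_ifs <;> simp [hZ']

end CapZ

/-! ### Large-mass gauges along `|m| → ∞` -/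

section Gauge

/-- Eventually along `|m| → ∞`: `‖m‖ ≥ √(2ν)` and `‖m‖ ≥ 1`. [folklore] -/
private theorem eventually_norm_ge (ν : ℕ) :
    ∀ᶠ m : ℂ in cobounded ℂ, Real.sqrt (2 * ν) ≤ ‖m‖ ∧ 1 ≤ ‖m‖ := by
  have h := (tendsto_norm_cobounded_atTop (E := ℂ)).eventually
    (eventually_ge_atTop (max (Real.sqrt (2 * ν)) 1))
  exact h.mono fun m hm => ⟨(le_max_left _ _).trans hm, (le_max_right _ _).trans hm⟩

/-- A complex number of norm `≥ 1` is nonzero. [folklore] -/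
private theorem ne_zero_of_one_le_norm {m : ℂ} (hm : 1 ≤ ‖m‖) : m ≠ 0 := by
  rintro rfl
  rw [norm_zero] at hm
  exact absurd hm (by norm_num)

/-- The norm of the real gauge `‖m‖⁻¹^n`. [folklore] -/
private theorem norm_gauge (m : ℂ) (n : ℕ) : ‖(‖m‖⁻¹ ^ n : ℝ)‖ = ‖m‖⁻¹ ^ n :=
  Real.norm_of_nonneg (by positivity)

/-- For `‖m‖ ≥ 1` the gauges decrease with the exponent. [folklore] -/
private theorem gauge_anti {m : ℂ} (hm : 1 ≤ ‖m‖) {a b : ℕ} (hab : a ≤ b) :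
    ‖m‖⁻¹ ^ b ≤ ‖m‖⁻¹ ^ a :=
  pow_le_pow_of_le_one (by positivity) (inv_le_one_of_one_le₀ hm) hab

/-- `‖m‖^{-b} = O(‖m‖^{-a})` along `|m| → ∞` for `a ≤ b`. [folklore] -/
private theorem isBigO_gauge_of_le {a b : ℕ} (hab : a ≤ b) :
    (fun m : ℂ => (‖m‖⁻¹ ^ b : ℝ)) =O[cobounded ℂ] fun m : ℂ => (‖m‖⁻¹ ^ a : ℝ) :=
  IsBigO.of_bound 1 ((eventually_norm_ge 0).mono fun m hm => by
    rw [norm_gauge, norm_gauge, one_mul]; exact gauge_anti hm.2 hab)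

/-- Product of gauges. [folklore] -/
private theorem gauge_mul (m : ℂ) (a b : ℕ) :
    (‖m‖⁻¹ ^ a : ℝ) * ‖m‖⁻¹ ^ b = ‖m‖⁻¹ ^ (a + b) := (pow_add _ _ _).symm

variable [NeZero L]

/-- `ρ_Λ(z,c) = O(1/|m|)` along `|m| → ∞`. [cite: HeilmannLieb1972, Lemma 4.4] -/
theorem njlCapRatio_isBigO {N : ℕ} (hN : 1 ≤ N) {c : TorusSite ν L →₀ ℕ} (hc : ∀ x, c x ≤ N)
    {z : TorusSite ν L} (hz : z ∈ c.support) :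
    njlCapRatio N z c =O[cobounded ℂ] fun m : ℂ => (‖m‖⁻¹ ^ 1 : ℝ) :=
  IsBigO.of_bound 1 ((eventually_norm_ge ν).mono fun m hm => by
    rw [norm_gauge, one_mul, pow_one]
    exact norm_njlCapRatio_le_inv hN hc (ne_zero_of_one_le_norm hm.2) hm.1 hz)

/-- `Z_Λ(d)/Z_Λ(c) = O(1)` along `|m| → ∞` for `d ≤ c`. [cite: HeilmannLieb1972, Lemma 4.4] -/
theorem njlCapZ_div_isBigO_one {N : ℕ} (hN : 1 ≤ N) {c d : TorusSite ν L →₀ ℕ} (hdc : d ≤ c)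
    (hc : ∀ x, c x ≤ N) :
    (fun m => njlCapZ N d m / njlCapZ N c m) =O[cobounded ℂ] fun m : ℂ => (‖m‖⁻¹ ^ 0 : ℝ) :=
  IsBigO.of_bound 1 ((eventually_norm_ge ν).mono fun m hm => by
    rw [norm_gauge, one_mul]
    exact (norm_njlCapZ_div_le hN hdc hc (ne_zero_of_one_le_norm hm.2) hm.1).trans
      (gauge_anti hm.2 (Nat.zero_le _)))

end Gauge

/-! ### Boxes of `ℤ^ν` read on the torus; local agreement of capacities -/

section Boxes

/-- `Torus.proj` is additive. [folklore] -/
private theorem torusProj_add (L : ℕ) (u v : Site ν) :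
    Torus.proj L (u + v) = Torus.proj L u + Torus.proj L v := by
  funext i; simp

/-- `Torus.proj` of `0`. [folklore] -/
private theorem torusProj_zero (L : ℕ) : Torus.proj L (0 : Site ν) = 0 := by
  funext i; simp

/-- `Torus.proj` of a negative. [folklore] -/
private theorem torusProj_neg (L : ℕ) (u : Site ν) : Torus.proj L (-u) = -Torus.proj L u := by
  funext i; simp

/-- `Torus.proj` of a coordinate vector. [folklore] -/
private theorem torusProj_single (L : ℕ) (μ : Fin ν) (k : ℤ) :
    Torus.proj L (Pi.single μ k : Site ν) = Pi.single μ (k : ZMod L) := by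
  funext i
  rcases eq_or_ne i μ with rfl | h
  · simp
  · simp [h]

/-- **Boxes embed**: reduction mod `L` is injective on the sup-norm box of radius `R` of `ℤ^ν` as
soon as `2R < L` (the periodic box `{0,…,L-1}^ν ≃ ℤ^ν/Lℤ^ν` of the torus boundary condition).
[cite: FriedliVelenik2017, §3.1] -/
theorem torusProj_injOn_box {L R : ℕ} (hL : 2 * R < L) {v w : Site ν} (hv : ∀ i, |v i| ≤ (R : ℤ))
    (hw : ∀ i, |w i| ≤ (R : ℤ)) (h : Torus.proj L v = Torus.proj L w) : v = w := by
  funext i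
  have hi := congr_fun h i
  simp only [Torus.proj_apply] at hi
  rw [ZMod.intCast_eq_intCast_iff_dvd_sub] at hi
  have h1 := abs_le.1 (hv i)
  have h2 := abs_le.1 (hw i)
  have hL' : (2 * R : ℤ) < L := by exact_mod_cast hL
  have habs : |w i - v i| < (L : ℤ) := abs_lt.2 ⟨by omega, by omega⟩
  have := Int.eq_zero_of_abs_lt_dvd hi habs
  omega

variable {L₁ L₂ : ℕ}

/-- **Local agreement of capacities.**  The capacities `c₁` on `Λ₁ = (ℤ/L₁ℤ)^ν` around `z₁` and `c₂`
on `Λ₂` around `z₂` agree on the box of radius `R`: `c₁(z₁ + v) = c₂(z₂ + v)` for every `v ∈ ℤ^ν`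
with `|v|_∞ ≤ R` (read on the tori).  This is the hypothesis under which the hopping expansions at
`z₁` and `z₂` agree to order `≈ 2R` (locality). [cite: SalmhoferSeiler1991, Remark 3.10] -/
def CapAgree (R : ℕ) (z₁ : TorusSite ν L₁) (c₁ : TorusSite ν L₁ →₀ ℕ) (z₂ : TorusSite ν L₂)
    (c₂ : TorusSite ν L₂ →₀ ℕ) : Prop :=
  ∀ v : Site ν, (∀ i, |v i| ≤ (R : ℤ)) → c₁ (z₁ + Torus.proj L₁ v) = c₂ (z₂ + Torus.proj L₂ v)

namespace CapAgree

variable {R : ℕ} {z₁ : TorusSite ν L₁} {c₁ : TorusSite ν L₁ →₀ ℕ} {z₂ : TorusSite ν L₂}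
  {c₂ : TorusSite ν L₂ →₀ ℕ}

/-- Agreement at the centre. [folklore] -/
private theorem center (h : CapAgree R z₁ c₁ z₂ c₂) : c₁ z₁ = c₂ z₂ := by
  have := h 0 fun i => by simp
  simpa [torusProj_zero] using this

/-- Agreement on a smaller box. [folklore] -/
private theorem mono {R' : ℕ} (h : CapAgree R z₁ c₁ z₂ c₂) (hR : R' ≤ R) : CapAgree R' z₁ c₁ z₂ c₂ :=
  fun v hv => h v fun i => (hv i).trans (by exact_mod_cast hR)

/-- Agreement around a shifted centre `z + u`, on the box of radius `R'` with `|u|_∞ + R' ≤ R`. [folklore] -/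
private theorem shift {R' : ℕ} (h : CapAgree R z₁ c₁ z₂ c₂) (u : Site ν)
    (hu : ∀ i, |u i| + (R' : ℤ) ≤ R) :
    CapAgree R' (z₁ + Torus.proj L₁ u) c₁ (z₂ + Torus.proj L₂ u) c₂ := by
  intro v hv
  have huv : ∀ i, |(u + v) i| ≤ (R : ℤ) := fun i => by
    rw [Pi.add_apply]
    exact (abs_add_le _ _).trans (by linarith [hu i, hv i])
  have := h (u + v) huv
  rwa [torusProj_add, torusProj_add, ← add_assoc, ← add_assoc] at this

/-- Agreement survives the removal of one unit of capacity at the centres (the boxes embed in both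
tori). [folklore] -/
private theorem sub_single (h : CapAgree R z₁ c₁ z₂ c₂) (hL₁ : 2 * R < L₁) (hL₂ : 2 * R < L₂) :
    CapAgree R z₁ (c₁ - Finsupp.single z₁ 1) z₂ (c₂ - Finsupp.single z₂ 1) := by
  intro v hv
  have h0 : ∀ i, |(0 : Site ν) i| ≤ (R : ℤ) := fun i => by simp
  have key₁ : (z₁ = z₁ + Torus.proj L₁ v) ↔ v = 0 := by
    constructor
    · intro he
      have : Torus.proj L₁ v = Torus.proj L₁ 0 := by
        rw [torusProj_zero]; exact (left_eq_add.1 he)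
      exact torusProj_injOn_box hL₁ hv h0 this
    · rintro rfl; simp [torusProj_zero]
  have key₂ : (z₂ = z₂ + Torus.proj L₂ v) ↔ v = 0 := by
    constructor
    · intro he
      have : Torus.proj L₂ v = Torus.proj L₂ 0 := by
        rw [torusProj_zero]; exact (left_eq_add.1 he)
      exact torusProj_injOn_box hL₂ hv h0 this
    · rintro rfl; simp [torusProj_zero]
  rw [Finsupp.tsub_apply, Finsupp.tsub_apply, Finsupp.single_apply, Finsupp.single_apply, h v hv]
  by_cases hv0 : v = 0
  · rw [if_pos (key₁.2 hv0), if_pos (key₂.2 hv0)]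
  · rw [if_neg (mt key₁.1 hv0), if_neg (mt key₂.1 hv0)]

end CapAgree

end Boxes

/-! ### Locality of the one-step ratios -/

section Locality

/-- Removing capacity keeps the bound `c ≤ N`. [folklore] -/
private theorem tsub_apply_le {L : ℕ} {N : ℕ} {c : TorusSite ν L →₀ ℕ} (hc : ∀ x, c x ≤ N)
    (l : TorusSite ν L →₀ ℕ) (x : TorusSite ν L) : (c - l) x ≤ N := by
  rw [Finsupp.tsub_apply]; exact (Nat.sub_le _ _).trans (hc x)

/-- **Locality of the hopping expansion, one-step ratios.**  If the capacities of two tori agree on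
boxes of radius `R` around `z₁`, `z₂` (both tori wider than `2R`) then, for `n ≤ 2R + 1`,
`ρ_{Λ₁}(z₁,c₁)(m) - ρ_{Λ₂}(z₂,c₂)(m) = O(|m|^{-n})` as `|m| → ∞`: the expansions of the two ratios
in the hopping parameter `1/(2m)` agree to order `n`.  Induction on `n` along the recursion
`c_z/ρ(z,c) = 2Nm + N ∑_{y∼z} ρ(y, c-δ_z)` (two orders gained per step, the box shrinking by one).
[cite: SalmhoferSeiler1991, Remark 3.10 and (3.46)][cite: HeilmannLieb1972, (4.20)] -/
theorem njlCapRatio_locality {N : ℕ} (hN : 1 ≤ N) (n : ℕ) :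
    ∀ {L₁ L₂ : ℕ} [NeZero L₁] [NeZero L₂] (R : ℕ) (z₁ : TorusSite ν L₁) (c₁ : TorusSite ν L₁ →₀ ℕ)
      (z₂ : TorusSite ν L₂) (c₂ : TorusSite ν L₂ →₀ ℕ),
      (∀ x, c₁ x ≤ N) → (∀ x, c₂ x ≤ N) → CapAgree R z₁ c₁ z₂ c₂ → n ≤ 2 * R + 1 →
      2 * R < L₁ → 2 * R < L₂ → z₁ ∈ c₁.support →
      (fun m => njlCapRatio N z₁ c₁ m - njlCapRatio N z₂ c₂ m) =O[cobounded ℂ]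
        fun m : ℂ => (‖m‖⁻¹ ^ n : ℝ) := by
  induction n using Nat.strong_induction_on with
  | _ n ih =>
  intro L₁ L₂ _ _ R z₁ c₁ z₂ c₂ hc₁ hc₂ hA hn hL₁ hL₂ hz₁
  have hκ : c₂ z₂ = c₁ z₁ := hA.center.symm
  have hz₂ : z₂ ∈ c₂.support := by
    rw [Finsupp.mem_support_iff] at hz₁ ⊢; rwa [hκ]
  rcases Nat.lt_or_ge n 2 with hn2 | hn2
  · -- orders 0 and 1: both ratios are `O(1/|m|)`
    exact ((njlCapRatio_isBigO hN hc₁ hz₁).sub (njlCapRatio_isBigO hN hc₂ hz₂)).trans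
      (isBigO_gauge_of_le (by omega))
  · -- order `n ≥ 2` from order `n - 2` at the neighbours
    obtain ⟨R', rfl⟩ : ∃ R', R = R' + 1 := ⟨R - 1, by omega⟩
    set c₁' := c₁ - Finsupp.single z₁ 1 with hc₁'def
    set c₂' := c₂ - Finsupp.single z₂ 1 with hc₂'def
    have hc₁' : ∀ x, c₁' x ≤ N := tsub_apply_le hc₁ _
    have hc₂' : ∀ x, c₂' x ≤ N := tsub_apply_le hc₂ _
    have hA' : CapAgree (R' + 1) z₁ c₁' z₂ c₂' := hA.sub_single hL₁ hL₂
    -- the neighbour terms of the recursion agree to order `n - 2`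
    have key : ∀ (u : Site ν) (y₁ : TorusSite ν L₁) (y₂ : TorusSite ν L₂), (∀ i, |u i| ≤ (1 : ℤ)) →
        y₁ = z₁ + Torus.proj L₁ u → y₂ = z₂ + Torus.proj L₂ u →
        (fun m => (if y₁ ∈ c₁'.support then njlCapRatio N y₁ c₁' m else 0) -
            (if y₂ ∈ c₂'.support then njlCapRatio N y₂ c₂' m else 0)) =O[cobounded ℂ]
          fun m : ℂ => (‖m‖⁻¹ ^ (n - 2) : ℝ) := by
      intro u y₁ y₂ hu hy₁ hy₂
      have hu' : ∀ i, |u i| ≤ ((R' + 1 : ℕ) : ℤ) := fun i => (hu i).trans (by push_cast; omega)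
      have hagree : c₁' y₁ = c₂' y₂ := by rw [hy₁, hy₂]; exact hA' u hu'
      by_cases hmem : y₁ ∈ c₁'.support
      · have hmem₂ : y₂ ∈ c₂'.support := by
          rw [Finsupp.mem_support_iff] at hmem ⊢; rwa [← hagree]
        simp only [hmem, hmem₂, if_true]
        subst hy₁ hy₂
        exact ih (n - 2) (by omega) R' _ _ _ _ hc₁' hc₂'
          (hA'.shift u fun i => by push_cast; linarith [hu i]) (by omega) (by omega) (by omega) hmem
      · have hmem₂ : y₂ ∉ c₂'.support := by
          rw [Finsupp.mem_support_iff, not_not] at hmem ⊢; rwa [← hagree]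
        simp only [hmem, hmem₂, if_false, sub_self]
        exact isBigO_zero _ _
    -- the two neighbours in direction `μ`
    have hplus : ∀ μ : Fin ν,
        (fun m => (if z₁ + Pi.single μ 1 ∈ c₁'.support then
              njlCapRatio N (z₁ + Pi.single μ 1) c₁' m else 0) -
            (if z₂ + Pi.single μ 1 ∈ c₂'.support then
              njlCapRatio N (z₂ + Pi.single μ 1) c₂' m else 0)) =O[cobounded ℂ]
          fun m : ℂ => (‖m‖⁻¹ ^ (n - 2) : ℝ) := fun μ =>
      key (Pi.single μ 1) _ _
        (fun i => by rcases eq_or_ne i μ with rfl | h <;> simp [*])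
        (by rw [torusProj_single, Int.cast_one]) (by rw [torusProj_single, Int.cast_one])
    have hminus : ∀ μ : Fin ν,
        (fun m => (if z₁ - Pi.single μ 1 ∈ c₁'.support then
              njlCapRatio N (z₁ - Pi.single μ 1) c₁' m else 0) -
            (if z₂ - Pi.single μ 1 ∈ c₂'.support then
              njlCapRatio N (z₂ - Pi.single μ 1) c₂' m else 0)) =O[cobounded ℂ]
          fun m : ℂ => (‖m‖⁻¹ ^ (n - 2) : ℝ) := fun μ =>
      key (-Pi.single μ 1) _ _
        (fun i => by rcases eq_or_ne i μ with rfl | h <;> simp [*])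
        (by rw [torusProj_neg, torusProj_single, Int.cast_one, sub_eq_add_neg])
        (by rw [torusProj_neg, torusProj_single, Int.cast_one, sub_eq_add_neg])
    -- the neighbour sums of the recursion
    set S₁ : ℂ → ℂ := fun m => ∑ μ : Fin ν,
      ((if z₁ + Pi.single μ 1 ∈ c₁'.support then njlCapRatio N (z₁ + Pi.single μ 1) c₁' m else 0) +
        (if z₁ - Pi.single μ 1 ∈ c₁'.support then njlCapRatio N (z₁ - Pi.single μ 1) c₁' m else 0))
      with hS₁
    set S₂ : ℂ → ℂ := fun m => ∑ μ : Fin ν,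
      ((if z₂ + Pi.single μ 1 ∈ c₂'.support then njlCapRatio N (z₂ + Pi.single μ 1) c₂' m else 0) +
        (if z₂ - Pi.single μ 1 ∈ c₂'.support then njlCapRatio N (z₂ - Pi.single μ 1) c₂' m else 0))
      with hS₂
    have hS : (fun m => S₁ m - S₂ m) =O[cobounded ℂ] fun m : ℂ => (‖m‖⁻¹ ^ (n - 2) : ℝ) := by
      have h := IsBigO.sum (s := (Finset.univ : Finset (Fin ν)))
        fun μ _ => (hplus μ).add (hminus μ)
      refine h.congr' (Eventually.of_forall fun m => ?_) EventuallyEq.rfl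
      simp only [hS₁, hS₂, ← Finset.sum_sub_distrib]
      refine Finset.sum_congr rfl fun μ _ => ?_
      ring
    -- the recursion, eventually
    have hκ0 : (c₁ z₁ : ℂ) ≠ 0 := by exact_mod_cast Finsupp.mem_support_iff.1 hz₁
    have hrec : ∀ᶠ m : ℂ in cobounded ℂ,
        (c₁ z₁ : ℂ) / njlCapRatio N z₁ c₁ m = 2 * N * m + N * S₁ m ∧
          (c₁ z₁ : ℂ) / njlCapRatio N z₂ c₂ m = 2 * N * m + N * S₂ m ∧
          njlCapRatio N z₁ c₁ m ≠ 0 ∧ njlCapRatio N z₂ c₂ m ≠ 0 := by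
      filter_upwards [eventually_norm_ge ν] with m hm
      have hm0 := ne_zero_of_one_le_norm hm.2
      refine ⟨?_, ?_, njlCapRatio_ne_zero hN hc₁ hm0 hm.1 z₁, njlCapRatio_ne_zero hN hc₂ hm0 hm.1 z₂⟩
      · rw [hS₁]; exact njlCapRatio_rec hN hc₁ hz₁ hm0 hm.1
      · rw [hS₂, show (c₁ z₁ : ℂ) = (c₂ z₂ : ℂ) by rw [hκ]]
        exact njlCapRatio_rec hN hc₂ hz₂ hm0 hm.1
    -- `ρ₁ - ρ₂ = ρ₁ ρ₂ (κ/ρ₂ - κ/ρ₁)/κ = (N/κ) ρ₁ ρ₂ (S₂ - S₁)`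
    have hT : (fun m => njlCapRatio N z₁ c₁ m * njlCapRatio N z₂ c₂ m *
        (((c₁ z₁ : ℂ))⁻¹ * N * (S₂ m - S₁ m))) =O[cobounded ℂ] fun m : ℂ => (‖m‖⁻¹ ^ n : ℝ) := by
      have h1 := (njlCapRatio_isBigO hN hc₁ hz₁).mul (njlCapRatio_isBigO hN hc₂ hz₂)
      have h2 : (fun m => ((c₁ z₁ : ℂ))⁻¹ * N * (S₂ m - S₁ m)) =O[cobounded ℂ]
          fun m : ℂ => (‖m‖⁻¹ ^ (n - 2) : ℝ) := by
        have := (hS.symm.const_mul_left (((c₁ z₁ : ℂ))⁻¹ * N))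
        refine this.congr_left fun m => ?_
        ring
      refine (h1.mul h2).congr_right fun m => ?_
      rw [gauge_mul, gauge_mul]
      congr 1
      omega
    refine hT.congr' ?_ EventuallyEq.rfl
    filter_upwards [hrec] with m ⟨h₁, h₂, hρ₁, hρ₂⟩
    have hSS : (N : ℂ) * (S₂ m - S₁ m) =
        (c₁ z₁ : ℂ) / njlCapRatio N z₂ c₂ m - (c₁ z₁ : ℂ) / njlCapRatio N z₁ c₁ m := by
      rw [h₁, h₂]; ring
    rw [mul_assoc ((c₁ z₁ : ℂ))⁻¹, hSS]
    field_simp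

/-! ### Locality of the correlation ratios `Z_Λ(c - l)/Z_Λ(c)` (telescoping) -/

/-- A multi-index on `ℤ^ν`, planted on the torus around the centre `z`. [cite: SalmhoferSeiler1991, (3.30)] -/
def plant (z : TorusSite ν L) (l : Site ν →₀ ℕ) : TorusSite ν L →₀ ℕ :=
  l.mapDomain fun x => z + Torus.proj L x

/-- Planting is injective on a box that embeds. [folklore] -/
private theorem plant_injOn {L R : ℕ} (hL : 2 * R < L) (z : TorusSite ν L) :
    Set.InjOn (fun x : Site ν => z + Torus.proj L x) {x : Site ν | ∀ i, |x i| ≤ (R : ℤ)} :=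
  fun _ hv _ hw h => torusProj_injOn_box hL hv hw (add_left_cancel h)

/-- The planted multi-index takes the value `l x` at `z + x` for `x` in an embedded box containing the
support. [folklore] -/
private theorem plant_apply {L R : ℕ} (hL : 2 * R < L) (z : TorusSite ν L) {l : Site ν →₀ ℕ}
    (hl : ∀ x ∈ l.support, ∀ i, |x i| ≤ (R : ℤ)) {x : Site ν} (hx : ∀ i, |x i| ≤ (R : ℤ)) :
    plant z l (z + Torus.proj L x) = l x :=
  Finsupp.mapDomain_apply' {x : Site ν | ∀ i, |x i| ≤ (R : ℤ)} l
    (fun y hy => by exact hl y (Finset.mem_coe.1 hy)) (plant_injOn hL z) hx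

/-- `plant z 0 = 0`. [folklore] -/
@[simp] private theorem plant_zero (z : TorusSite ν L) : plant z (0 : Site ν →₀ ℕ) = 0 := by
  simp [plant]

/-- Planting is additive. [folklore] -/
private theorem plant_add (z : TorusSite ν L) (l l' : Site ν →₀ ℕ) :
    plant z (l + l') = plant z l + plant z l' := by
  simp [plant, Finsupp.mapDomain_add]

/-- Planting a unit. [folklore] -/
private theorem plant_single (z : TorusSite ν L) (x : Site ν) (k : ℕ) :
    plant z (Finsupp.single x k) = Finsupp.single (z + Torus.proj L x) k := by
  simp [plant, Finsupp.mapDomain_single]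

/-- A planted multi-index fits under the capacities if it does so pointwise on its support. [folklore] -/
private theorem plant_le {L R : ℕ} (hL : 2 * R < L) (z : TorusSite ν L) {l : Site ν →₀ ℕ}
    (hl : ∀ x ∈ l.support, ∀ i, |x i| ≤ (R : ℤ)) {c : TorusSite ν L →₀ ℕ}
    (hlc : ∀ x ∈ l.support, l x ≤ c (z + Torus.proj L x)) : plant z l ≤ c := by
  classical
  intro y
  by_cases hy : y ∈ (plant z l).support
  · obtain ⟨x, hx, rfl⟩ : ∃ x ∈ l.support, z + Torus.proj L x = y := by
      simpa using Finsupp.mapDomain_support hy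
    rw [plant_apply hL z hl (hl x hx)]
    exact hlc x hx
  · rw [Finsupp.notMem_support_iff.1 hy]; exact Nat.zero_le _

variable {L₁ L₂ : ℕ} [NeZero L₁] [NeZero L₂]

/-- **Locality of the hopping expansion, correlation ratios.**  If the capacities of two tori agree
on boxes of radius `R` around `z₁`, `z₂` (tori wider than `2R`), `l` is a multi-index on `ℤ^ν` with
`|x|_∞ + n ≤ R` on its support which fits under the capacities, then
`Z_{Λ₁}(c₁ - l)/Z_{Λ₁}(c₁) - Z_{Λ₂}(c₂ - l)/Z_{Λ₂}(c₂) = O(|m|^{-n})` as `|m| → ∞` (`l` planted at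
`z₁` resp. `z₂`): telescoping of `njlCapRatio_locality` one unit of `l` at a time.
[cite: SalmhoferSeiler1991, Remark 3.10 and (3.30)][cite: HeilmannLieb1972, (4.20)] -/
theorem njlCapZ_div_locality {N : ℕ} (hN : 1 ≤ N) (n : ℕ) (l : Site ν →₀ ℕ) :
    ∀ {L₁ L₂ : ℕ} [NeZero L₁] [NeZero L₂] (R : ℕ) (z₁ : TorusSite ν L₁) (c₁ : TorusSite ν L₁ →₀ ℕ)
      (z₂ : TorusSite ν L₂) (c₂ : TorusSite ν L₂ →₀ ℕ),
      (∀ x, c₁ x ≤ N) → (∀ x, c₂ x ≤ N) → CapAgree R z₁ c₁ z₂ c₂ → n ≤ R → 2 * R < L₁ → 2 * R < L₂ →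
      (∀ x ∈ l.support, ∀ i, |x i| + (n : ℤ) ≤ R) →
      (∀ x ∈ l.support, l x ≤ c₁ (z₁ + Torus.proj L₁ x)) →
      (fun m => njlCapZ N (c₁ - plant z₁ l) m / njlCapZ N c₁ m -
          njlCapZ N (c₂ - plant z₂ l) m / njlCapZ N c₂ m) =O[cobounded ℂ]
        fun m : ℂ => (‖m‖⁻¹ ^ n : ℝ) := by
  classical
  intro L₁ L₂ i₁ i₂ R z₁ c₁ z₂ c₂ hc₁ hc₂ hA hn hL₁ hL₂ hbox hlc
  suffices H : ∀ (k : ℕ) (l : Site ν →₀ ℕ), l.degree = k →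
      ∀ {L₁ L₂ : ℕ} [NeZero L₁] [NeZero L₂] (R : ℕ) (z₁ : TorusSite ν L₁) (c₁ : TorusSite ν L₁ →₀ ℕ)
        (z₂ : TorusSite ν L₂) (c₂ : TorusSite ν L₂ →₀ ℕ),
        (∀ x, c₁ x ≤ N) → (∀ x, c₂ x ≤ N) → CapAgree R z₁ c₁ z₂ c₂ → n ≤ R → 2 * R < L₁ →
        2 * R < L₂ → (∀ x ∈ l.support, ∀ i, |x i| + (n : ℤ) ≤ R) →
        (∀ x ∈ l.support, l x ≤ c₁ (z₁ + Torus.proj L₁ x)) →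
        (fun m => njlCapZ N (c₁ - plant z₁ l) m / njlCapZ N c₁ m -
            njlCapZ N (c₂ - plant z₂ l) m / njlCapZ N c₂ m) =O[cobounded ℂ]
          fun m : ℂ => (‖m‖⁻¹ ^ n : ℝ) from H _ l rfl R z₁ c₁ z₂ c₂ hc₁ hc₂ hA hn hL₁ hL₂ hbox hlc
  clear hlc hbox hL₁ hL₂ hn hA hc₁ hc₂ c₁ c₂ z₁ z₂ R
  intro k
  induction k with
  | zero =>
    intro l hl L₁ L₂ _ _ R z₁ c₁ z₂ c₂ hc₁ hc₂ hA hn hL₁ hL₂ hbox hlc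
    obtain rfl : l = 0 := (Finsupp.degree_eq_zero_iff l).1 hl
    refine (isBigO_zero _ _).congr' ?_ EventuallyEq.rfl
    filter_upwards [eventually_norm_ge ν] with m hm
    have hm0 := ne_zero_of_one_le_norm hm.2
    rw [plant_zero, plant_zero, tsub_zero, tsub_zero, div_self (njlCapZ_ne_zero hN hc₁ hm0 hm.1),
      div_self (njlCapZ_ne_zero hN hc₂ hm0 hm.1), sub_self]
  | succ k ih =>
    intro l hl L₁ L₂ _ _ R z₁ c₁ z₂ c₂ hc₁ hc₂ hA hn hL₁ hL₂ hbox hlc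
    -- split off one unit of `l` at a point `x` of its support
    have hl0 : l ≠ 0 := by
      intro h; rw [h, map_zero] at hl; exact Nat.succ_ne_zero k hl.symm
    obtain ⟨x, hx⟩ := Finsupp.support_nonempty_iff.2 hl0
    have hx1 : 1 ≤ l x := Nat.one_le_iff_ne_zero.2 (Finsupp.mem_support_iff.1 hx)
    set l' := l - Finsupp.single x 1 with hl'def
    have hll' : l = l' + Finsupp.single x 1 :=
      (tsub_add_cancel_of_le (Finsupp.single_le_iff.2 hx1)).symm
    have hl'deg : l'.degree = k := by
      have := congrArg Finsupp.degree hll'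
      rw [map_add, Finsupp.degree_single, hl] at this
      omega
    have hl'le : l' ≤ l := tsub_le_self
    have hsupp' : l'.support ⊆ l.support := Finsupp.support_mono hl'le
    have hbox' : ∀ y ∈ l'.support, ∀ i, |y i| + (n : ℤ) ≤ R := fun y hy => hbox y (hsupp' hy)
    have hlc' : ∀ y ∈ l'.support, l' y ≤ c₁ (z₁ + Torus.proj L₁ y) :=
      fun y hy => (hl'le y).trans (hlc y (hsupp' hy))
    -- boxes: the support of `l` lies in the box of radius `R`
    have hboxR : ∀ y ∈ l.support, ∀ i, |y i| ≤ (R : ℤ) := fun y hy i => by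
      have := hbox y hy i; have : (0 : ℤ) ≤ n := Nat.cast_nonneg n; linarith
    have hboxR' : ∀ y ∈ l'.support, ∀ i, |y i| ≤ (R : ℤ) := fun y hy => hboxR y (hsupp' hy)
    have hxR : ∀ i, |x i| ≤ (R : ℤ) := hboxR x hx
    -- the capacities after removal of `l'`
    set d₁ := c₁ - plant z₁ l' with hd₁
    set d₂ := c₂ - plant z₂ l' with hd₂
    have hd₁N : ∀ y, d₁ y ≤ N := tsub_apply_le hc₁ _
    have hd₂N : ∀ y, d₂ y ≤ N := tsub_apply_le hc₂ _
    -- they agree on the box of radius `n` around `z + x`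
    have hAd : CapAgree n (z₁ + Torus.proj L₁ x) d₁ (z₂ + Torus.proj L₂ x) d₂ := by
      intro v hv
      have hxv : ∀ i, |(x + v) i| ≤ (R : ℤ) := fun i => by
        rw [Pi.add_apply]
        exact (abs_add_le _ _).trans (by linarith [hbox x hx i, hv i])
      rw [add_assoc, ← torusProj_add, add_assoc, ← torusProj_add, hd₁, hd₂, Finsupp.tsub_apply,
        Finsupp.tsub_apply, plant_apply hL₁ z₁ hboxR' hxv, plant_apply hL₂ z₂ hboxR' hxv,
        hA (x + v) hxv]
    -- the removal point has capacity in `d₁`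
    have hxd₁ : z₁ + Torus.proj L₁ x ∈ d₁.support := by
      rw [Finsupp.mem_support_iff, hd₁, Finsupp.tsub_apply, plant_apply hL₁ z₁ hboxR' hxR]
      have h1 : l' x + 1 = l x := by
        rw [hl'def, Finsupp.tsub_apply, Finsupp.single_eq_same]; omega
      have h2 := hlc x hx
      omega
    -- one-step factors `A` and the remaining ratios `B`
    have hA₁₂ := njlCapRatio_locality hN n n (z₁ + Torus.proj L₁ x) d₁ (z₂ + Torus.proj L₂ x) d₂
      hd₁N hd₂N hAd (by omega) (by omega) (by omega) hxd₁
    have hB₁₂ := ih l' hl'deg R z₁ c₁ z₂ c₂ hc₁ hc₂ hA hn hL₁ hL₂ hbox' hlc'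
    have hA₁ : njlCapRatio N (z₁ + Torus.proj L₁ x) d₁ =O[cobounded ℂ] fun m : ℂ => (‖m‖⁻¹ ^ 0 : ℝ) :=
      (njlCapRatio_isBigO hN hd₁N hxd₁).trans (isBigO_gauge_of_le (Nat.zero_le 1))
    have hB₂ : (fun m => njlCapZ N d₂ m / njlCapZ N c₂ m) =O[cobounded ℂ]
        fun m : ℂ => (‖m‖⁻¹ ^ 0 : ℝ) :=
      njlCapZ_div_isBigO_one hN tsub_le_self hc₂
    -- `X₁ - X₂ = A₁ (B₁ - B₂) + (A₁ - A₂) B₂`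
    have hT : (fun m => njlCapRatio N (z₁ + Torus.proj L₁ x) d₁ m *
          (njlCapZ N d₁ m / njlCapZ N c₁ m - njlCapZ N d₂ m / njlCapZ N c₂ m) +
        (njlCapRatio N (z₁ + Torus.proj L₁ x) d₁ m - njlCapRatio N (z₂ + Torus.proj L₂ x) d₂ m) *
          (njlCapZ N d₂ m / njlCapZ N c₂ m)) =O[cobounded ℂ] fun m : ℂ => (‖m‖⁻¹ ^ n : ℝ) := by
      have h1 := (hA₁.mul hB₁₂).congr_right fun m => by rw [gauge_mul, zero_add]
      have h2 := (hA₁₂.mul hB₂).congr_right fun m => by rw [gauge_mul, add_zero]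
      exact h1.add h2
    refine hT.congr' ?_ EventuallyEq.rfl
    filter_upwards [eventually_norm_ge ν] with m hm
    have hm0 := ne_zero_of_one_le_norm hm.2
    have hZ₁ : njlCapZ N d₁ m ≠ 0 := njlCapZ_ne_zero hN hd₁N hm0 hm.1
    have hZ₂ : njlCapZ N d₂ m ≠ 0 := njlCapZ_ne_zero hN hd₂N hm0 hm.1
    have he₁ : c₁ - plant z₁ l = d₁ - Finsupp.single (z₁ + Torus.proj L₁ x) 1 := by
      rw [hll', plant_add, plant_single, hd₁, tsub_add_eq_tsub_tsub]
    have he₂ : c₂ - plant z₂ l = d₂ - Finsupp.single (z₂ + Torus.proj L₂ x) 1 := by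
      rw [hll', plant_add, plant_single, hd₂, tsub_add_eq_tsub_tsub]
    rw [he₁, he₂]
    unfold njlCapRatio
    field_simp
    ring

/-! ### Locality of the correlation functions `⟨σ^d⟩_Λ(m)` -/

/-- The torus reading of a multi-index on `ℤ^ν` is its planting at the origin. [folklore] -/
private theorem mapDomain_proj_eq_plant (L : ℕ) (d : Site ν →₀ ℕ) :
    Finsupp.mapDomain (Torus.proj L) d = plant (0 : TorusSite ν L) d := by
  unfold plant
  congr 1
  funext x
  rw [zero_add]

/-- `⟨σ^d⟩_Λ(m) = Z_Λ(N - d)(m) / Z_Λ(N)(m)` when the support of `d` embeds in the torus and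
`d ≤ N`. [cite: SalmhoferSeiler1991, Remark 3.2 and (3.30)] -/
theorem njlCorrelation_eq_div {N L R : ℕ} [NeZero L] (hL : 2 * R < L) {d : Site ν →₀ ℕ}
    (hd : ∀ x, d x ≤ N) (hbox : ∀ x ∈ d.support, ∀ i, |x i| ≤ (R : ℤ)) (m : ℂ) :
    njlCorrelation N L d m =
      njlCapZ N (topExponent N - plant (0 : TorusSite ν L) d) m /
        njlCapZ N (topExponent (ν := ν) (L := L) N) m := by
  have hle : plant (0 : TorusSite ν L) d ≤ topExponent N :=
    plant_le hL 0 hbox fun x _ => by rw [topExponent_apply']; exact hd x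
  unfold njlCorrelation njlExpectC
  rw [njlBracketC_monomial, njlPartitionFunctionC_eq_Z, mapDomain_proj_eq_plant, if_pos hle]
  rfl

/-- **Locality of the hopping expansion of the correlation functions.**  For the NJL system (`N ≥ 1`),
a multi-index `d ≤ N` on `ℤ^ν`, an order `n` and a radius `R` with `|x|_∞ + n ≤ R` on the support of
`d`: for ALL tori `Λ₁`, `Λ₂` of sides `> 2R`,
`⟨σ^d⟩_{Λ₁}(m) - ⟨σ^d⟩_{Λ₂}(m) = O(|m|^{-n})` as `|m| → ∞` — the hopping-parameter expansions
(Remark 3.10) of the finite-volume correlation functions agree to order `n` as soon as the volume is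
large, the input "contained in [20]" of Theorem 3.8 (1). [cite: SalmhoferSeiler1991, Thm. 3.8 (1) and Remark 3.10][cite: GruberKunz1971, §3] -/
theorem njlCorrelation_sub_isBigO {N : ℕ} (hN : 1 ≤ N) {d : Site ν →₀ ℕ} (hd : ∀ x, d x ≤ N)
    (n R : ℕ) (hnR : n ≤ R) (hbox : ∀ x ∈ d.support, ∀ i, |x i| + (n : ℤ) ≤ R)
    {L₁ L₂ : ℕ} [NeZero L₁] [NeZero L₂] (hL₁ : 2 * R < L₁) (hL₂ : 2 * R < L₂) :
    (fun m => njlCorrelation N L₁ d m - njlCorrelation N L₂ d m) =O[cobounded ℂ]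
      fun m : ℂ => (‖m‖⁻¹ ^ n : ℝ) := by
  have hboxR : ∀ x ∈ d.support, ∀ i, |x i| ≤ (R : ℤ) := fun x hx i => by
    have := hbox x hx i; have : (0 : ℤ) ≤ n := Nat.cast_nonneg n; linarith
  have htop₁ : ∀ x, topExponent (ν := ν) (L := L₁) N x ≤ N := fun x => (topExponent_apply' N x).le
  have htop₂ : ∀ x, topExponent (ν := ν) (L := L₂) N x ≤ N := fun x => (topExponent_apply' N x).le
  have hA : CapAgree R (0 : TorusSite ν L₁) (topExponent N) (0 : TorusSite ν L₂) (topExponent N) :=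
    fun v _ => by rw [topExponent_apply', topExponent_apply']
  have h := njlCapZ_div_locality hN n d R 0 (topExponent N) 0 (topExponent N) htop₁ htop₂ hA hnR
    hL₁ hL₂ hbox fun x _ => by rw [topExponent_apply']; exact hd x
  refine h.congr_left fun m => ?_
  rw [njlCorrelation_eq_div hL₁ hd hboxR, njlCorrelation_eq_div hL₂ hd hboxR]

/-- **Every multi-index has a locality radius**: for `d` on `ℤ^ν` and an order `n` there is `R ≥ n`
with `|x|_∞ + n ≤ R` on the support of `d`. [folklore] -/
private theorem exists_localityRadius (d : Site ν →₀ ℕ) (n : ℕ) :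
    ∃ R : ℕ, n ≤ R ∧ ∀ x ∈ d.support, ∀ i, |x i| + (n : ℤ) ≤ R := by
  classical
  refine ⟨d.support.sup (fun x => Finset.univ.sup fun i => (x i).natAbs) + n, by omega, ?_⟩
  intro x hx i
  have h1 : (x i).natAbs ≤ Finset.univ.sup fun j => (x j).natAbs :=
    Finset.le_sup (f := fun j => (x j).natAbs) (Finset.mem_univ i)
  have h2 : (Finset.univ.sup fun j => (x j).natAbs) ≤
      d.support.sup fun y => Finset.univ.sup fun j => (y j).natAbs :=
    Finset.le_sup (f := fun y => Finset.univ.sup fun j => (y j).natAbs) hx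
  have h3 : |x i| = ((x i).natAbs : ℤ) := (Int.natCast_natAbs (x i)).symm
  rw [h3]
  push_cast
  omega

/-- **Locality, volume form**: for the NJL system (`N ≥ 1`), a multi-index `d ≤ N` on `ℤ^ν` and
every order `n` there is a size `R` such that for ALL tori `Λ₁`, `Λ₂` of sides `> 2R`,
`⟨σ^d⟩_{Λ₁}(m) - ⟨σ^d⟩_{Λ₂}(m) = O(|m|^{-n})` as `|m| → ∞`: the hopping-parameter expansion of
`⟨σ^d⟩_Λ` stabilises, order by order, as the volume grows (the large-mass input of Thm. 3.8 (1)).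
[cite: SalmhoferSeiler1991, Thm. 3.8 (1) and Remark 3.10][cite: GruberKunz1971, §3] -/
theorem exists_njlCorrelation_sub_isBigO {N : ℕ} (hN : 1 ≤ N) {d : Site ν →₀ ℕ}
    (hd : ∀ x, d x ≤ N) (n : ℕ) :
    ∃ R : ℕ, ∀ (L₁ L₂ : ℕ) [NeZero L₁] [NeZero L₂], 2 * R < L₁ → 2 * R < L₂ →
      (fun m => njlCorrelation N L₁ d m - njlCorrelation N L₂ d m) =O[cobounded ℂ]
        fun m : ℂ => (‖m‖⁻¹ ^ n : ℝ) := by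
  obtain ⟨R, hnR, hbox⟩ := exists_localityRadius d n
  exact ⟨R, fun L₁ L₂ _ _ hL₁ hL₂ => njlCorrelation_sub_isBigO hN hd n R hnR hbox hL₁ hL₂⟩

end Locality

end ComplexSpin

end Literature.MathematicalPhysics.StatisticalMechanics
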